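import Summits.AnomalousDissipation.AnomalousDissipation.Theorems.MirrorVarietyTaylorGreenLoudGalerkinStatesLine
import Summits.AnomalousDissipation.AnomalousDissipation.Theorems.TaylorGreenLoudGalerkinStates.Negative.Anatomy

/-!
# Stub `stub_tgForceRegular` of the line `stagnation-plug-froth`
# (crux stmt-AnomalousDissipation-2987, `MirrorVariety.TaylorGreenLoudGalerkinStates`)

`IsKField tgForce`: the Taylor–Green force
`f_TG = (sin 2πx₀ cos 2πx₁ cos 2πx₂, −cos 2πx₀ sin 2πx₁ cos 2πx₂, 0)` is smooth, divergence-free, mean-zero and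
`K`-symmetric (equivariant under the three coordinate reflections `R_i : x_i ↦ -x_i` of `T³`).

* Smooth / div-free / mean-zero are IMPORTED from the landed negative-knowledge file
  `Theorems/TaylorGreenLoudGalerkinStates/Negative/Anatomy.lean` (`Negative.isSmooth_tgForce`,
  `Negative.isDivFree_tgForce`, `Negative.hasZeroMean_tgForce`: `f_TG` is the explicit real trigonometric
  polynomial `tgForce_eq_realTrigPoly` on the shell `|k|² = 3` with transversal coefficients, and `0 ∉` shell).
* `K`-symmetry (`isKSymm_tgForce`) is proved here coordinatewise: `(R_i x)_l = ∓x_l`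
  (`mulVecT_reflMat_apply`), `(R_i v)_l = ∓v_l` (`actVec_reflMat_apply`), and the parity of the characters
  `e_n(-y) = conj e_n(y)` (`fourier_neg_arg`), so `cos 2πt = Re e_1(t)` is even and `sin 2πt = Im e_1(t)` is odd.

Sources: the vocabulary module `Theorems/MirrorVarietyTaylorGreenLoudGalerkinStatesLine.lean`; the `K`-symmetry
lemmas are adapted from the refuter's work file `Cruxes/TaylorGreenLoudGalerkinStates/Disproof.lean` §4a
(refuter-cdisprove-stmt-AnomalousDissipation-2987-0); Brachet et al., J. Fluid Mech. 130 (1983) §2 (symmetries of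
the Taylor–Green vortex) for the mathematics, which is folklore.
-/

-- `Summit.<Summit>.<Problem>` is the tree's mandated summit-side namespace (CONVENTIONS §2); for this
-- single-conjunct summit the two coincide, so the duplicate is deliberate.
set_option linter.dupNamespace false

noncomputable section

open scoped BigOperators Topology InnerProductSpace ComplexConjugate
open Filter MeasureTheory
open Literature.Analysis.FunctionSpaces Literature.Analysis.FunctionSpaces.Torus

namespace Summit.AnomalousDissipation.AnomalousDissipation.Theorems.TaylorGreenLoudGalerkinStates.TgForceRegular

open Summit.AnomalousDissipation.AnomalousDissipation.Theorems.TaylorGreenLoudGalerkinStates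
open Summit.AnomalousDissipation.AnomalousDissipation.Theorems.TaylorGreenLoudGalerkinStates.Negative

/-! ## The three reflections, coordinatewise -/

-- The lemmas of this section and the next are adapted from Cruxes/TaylorGreenLoudGalerkinStates/Disproof.lean §4a
-- (refuter-cdisprove-stmt-AnomalousDissipation-2987-0), restated against the tree vocabulary.

/-- Coordinates of the reflected torus point: `(R_i x)_l = -x_l` if `l = i`, else `x_l`. [folklore] -/
theorem mulVecT_reflMat_apply (i : Fin 3) (x : UnitAddTorus (Fin 3)) (l : Fin 3) :
    Torus.mulVecT (reflMat i) x l = if l = i then -x l else x l := by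
  rw [Torus.mulVecT_apply]
  simp only [reflMat, Matrix.diagonal_apply, ite_smul, zero_smul, Finset.sum_ite_eq, Finset.mem_univ, if_true]
  split_ifs <;> simp

/-- Coordinates of the reflected vector: `(R_i v)_j = -v_j` if `j = i`, else `v_j`. [folklore] -/
theorem actVec_reflMat_apply (i : Fin 3) (v : EuclideanSpace ℝ (Fin 3)) (j : Fin 3) :
    actVec (reflMat i) v j = if j = i then -v j else v j := by
  simp only [actVec, reflMat, PiLp.toLp_apply, Matrix.mulVec, dotProduct, Matrix.map_apply,
    Matrix.diagonal_apply]
  simp only [apply_ite (Int.cast : ℤ → ℝ), Int.cast_neg, Int.cast_one, Int.cast_zero, ite_mul, zero_mul,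
    Finset.sum_ite_eq, Finset.mem_univ, if_true]
  split_ifs <;> simp

/-- `e_n(-y) = conj e_n(y)` for the Fourier characters of the unit circle. [folklore] -/
theorem fourier_neg_arg (n : ℤ) (y : UnitAddCircle) : fourier n (-y) = conj (fourier n y) := by
  rw [← fourier_neg, fourier_apply, fourier_apply, neg_smul, smul_neg]

/-- The reflected torus point, coordinatewise, for each of the three reflections. [folklore] -/
theorem mulVecT_reflMat_coords (x : UnitAddTorus (Fin 3)) :
    (Torus.mulVecT (reflMat 0) x 0 = -x 0 ∧ Torus.mulVecT (reflMat 0) x 1 = x 1 ∧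
        Torus.mulVecT (reflMat 0) x 2 = x 2) ∧
    (Torus.mulVecT (reflMat 1) x 0 = x 0 ∧ Torus.mulVecT (reflMat 1) x 1 = -x 1 ∧
        Torus.mulVecT (reflMat 1) x 2 = x 2) ∧
    (Torus.mulVecT (reflMat 2) x 0 = x 0 ∧ Torus.mulVecT (reflMat 2) x 1 = x 1 ∧
        Torus.mulVecT (reflMat 2) x 2 = -x 2) := by
  refine ⟨⟨?_, ?_, ?_⟩, ⟨?_, ?_, ?_⟩, ⟨?_, ?_, ?_⟩⟩ <;> simp [mulVecT_reflMat_apply]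

/-- The reflected vector, coordinatewise, for each of the three reflections. [folklore] -/
theorem actVec_reflMat_coords (v : EuclideanSpace ℝ (Fin 3)) :
    (actVec (reflMat 0) v 0 = -v 0 ∧ actVec (reflMat 0) v 1 = v 1 ∧ actVec (reflMat 0) v 2 = v 2) ∧
    (actVec (reflMat 1) v 0 = v 0 ∧ actVec (reflMat 1) v 1 = -v 1 ∧ actVec (reflMat 1) v 2 = v 2) ∧
    (actVec (reflMat 2) v 0 = v 0 ∧ actVec (reflMat 2) v 1 = v 1 ∧ actVec (reflMat 2) v 2 = -v 2) := by
  refine ⟨⟨?_, ?_, ?_⟩, ⟨?_, ?_, ?_⟩, ⟨?_, ?_, ?_⟩⟩ <;> simp [actVec_reflMat_apply]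

/-! ## `K`-symmetry of the Taylor–Green force -/

/-- Components of `f_TG`: `(sin·cos·cos, −cos·sin·cos, 0)` in terms of the Fourier characters. [folklore] -/
theorem tgForce_apply_coords (y : UnitAddTorus (Fin 3)) :
    tgForce y 0 = (fourier 1 (y 0) : ℂ).im * (fourier 1 (y 1) : ℂ).re * (fourier 1 (y 2) : ℂ).re ∧
    tgForce y 1 = -((fourier 1 (y 0) : ℂ).re * (fourier 1 (y 1) : ℂ).im * (fourier 1 (y 2) : ℂ).re) ∧
    tgForce y 2 = 0 := by
  refine ⟨?_, ?_, ?_⟩ <;> simp [tgForce]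

/-- Extensionality in `ℝ³` by the three coordinates. [folklore] -/
theorem euclid_ext3 {u v : EuclideanSpace ℝ (Fin 3)} (h0 : u 0 = v 0) (h1 : u 1 = v 1) (h2 : u 2 = v 2) :
    u = v := by
  ext j
  fin_cases j <;> assumption

/-- `f_TG (R_0 x) = R_0 f_TG (x)` (`sin 2πx₀` is odd, the other factors are even in `x₀`). [folklore] -/
theorem tgForce_refl0 (x : UnitAddTorus (Fin 3)) :
    tgForce (Torus.mulVecT (reflMat 0) x) = actVec (reflMat 0) (tgForce x) := by
  obtain ⟨⟨a0, a1, a2⟩, -, -⟩ := mulVecT_reflMat_coords x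
  obtain ⟨⟨d0, d1, d2⟩, -, -⟩ := actVec_reflMat_coords (tgForce x)
  obtain ⟨t0, t1, t2⟩ := tgForce_apply_coords x
  obtain ⟨s0, s1, s2⟩ := tgForce_apply_coords (Torus.mulVecT (reflMat 0) x)
  refine euclid_ext3 ?_ ?_ ?_
  · rw [s0, d0, t0, a0, a1, a2, fourier_neg_arg, Complex.conj_im]; ring
  · rw [s1, d1, t1, a0, a1, a2, fourier_neg_arg, Complex.conj_re]
  · rw [s2, d2, t2]

/-- `f_TG (R_1 x) = R_1 f_TG (x)` (`sin 2πx₁` is odd, the other factors are even in `x₁`). [folklore] -/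
theorem tgForce_refl1 (x : UnitAddTorus (Fin 3)) :
    tgForce (Torus.mulVecT (reflMat 1) x) = actVec (reflMat 1) (tgForce x) := by
  obtain ⟨-, ⟨b0, b1, b2⟩, -⟩ := mulVecT_reflMat_coords x
  obtain ⟨-, ⟨e0, e1, e2⟩, -⟩ := actVec_reflMat_coords (tgForce x)
  obtain ⟨t0, t1, t2⟩ := tgForce_apply_coords x
  obtain ⟨s0, s1, s2⟩ := tgForce_apply_coords (Torus.mulVecT (reflMat 1) x)
  refine euclid_ext3 ?_ ?_ ?_
  · rw [s0, e0, t0, b0, b1, b2, fourier_neg_arg, Complex.conj_re]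
  · rw [s1, e1, t1, b0, b1, b2, fourier_neg_arg, Complex.conj_im]; ring
  · rw [s2, e2, t2]

/-- `f_TG (R_2 x) = R_2 f_TG (x)` (`cos 2πx₂` is even; the third component is `0 = -0`). [folklore] -/
theorem tgForce_refl2 (x : UnitAddTorus (Fin 3)) :
    tgForce (Torus.mulVecT (reflMat 2) x) = actVec (reflMat 2) (tgForce x) := by
  obtain ⟨-, -, ⟨c0, c1, c2⟩⟩ := mulVecT_reflMat_coords x
  obtain ⟨-, -, ⟨g0, g1, g2⟩⟩ := actVec_reflMat_coords (tgForce x)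
  obtain ⟨t0, t1, t2⟩ := tgForce_apply_coords x
  obtain ⟨s0, s1, s2⟩ := tgForce_apply_coords (Torus.mulVecT (reflMat 2) x)
  refine euclid_ext3 ?_ ?_ ?_
  · rw [s0, g0, t0, c0, c1, c2, fourier_neg_arg, Complex.conj_re]
  · rw [s1, g1, t1, c0, c1, c2, fourier_neg_arg, Complex.conj_re]
  · rw [s2, g2, t2, neg_zero]

/-- **`f_TG` is `K`-symmetric**: `f_TG (R_i x) = R_i f_TG (x)` for the three coordinate reflections
(`sin` odd, `cos` even). [folklore] -/
theorem isKSymm_tgForce : IsKSymm tgForce := by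
  intro i x
  fin_cases i
  · exact tgForce_refl0 x
  · exact tgForce_refl1 x
  · exact tgForce_refl2 x

/-! ## The registered stub -/

/-- **Stub `stub_tgForceRegular`.** The Taylor–Green force is a `K`-field: smooth, divergence-free, mean-zero
(`Negative.isSmooth_tgForce`, `Negative.isDivFree_tgForce`, `Negative.hasZeroMean_tgForce`, via the explicit
trigonometric polynomial `Negative.tgForce_eq_realTrigPoly` on the shell `|k|² = 3`) and `K`-symmetric
(`isKSymm_tgForce`). [folklore] -/
theorem stub_tgForceRegular :
    IsKField tgForce :=
  ⟨isSmooth_tgForce, isDivFree_tgForce, hasZeroMean_tgForce, isKSymm_tgForce⟩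

end Summit.AnomalousDissipation.AnomalousDissipation.Theorems.TaylorGreenLoudGalerkinStates.TgForceRegular

end
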